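import Summits.QuantumFields.YangMills.Theorems.BalabanUVNodesN26BetaContRecord

/-!
# DAG node N26 — binder B4 AT THE β OF RECORD, DESIGN (β) OF RECORD (`Node00.betaOfMerged (betaMerged F ℰ ρ bV) β⁰ γ`):
# the rows-(D4) ∧ B4 residue `AtSlopeCont` for the record's definitional split `oneLoopSplit_betaOfMerged` from NAMED located
# inputs (the (D4) socket at `D₀`'s β, merged-term reading), (C-pt) at finite volume from joint `C²` regularity, and consistency

Cell `pub-ymgap`, YM-PLAN Track A (HUMAN RULING D-0062), seat `pub-ymgap-dag-n26-a` (gen 2; -a = KNIT-BY-NAME); companion of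
`BalabanUVNodesN26BetaContRecord` (same seat: the socket for the two-family shape `betaOfTerms`).  NODE 00's design word for Stage
₈b ([NODE00-G28-BETA-DESIGN-WORD], pub-ymgap INBOX l.9513): (i) β ON the box is `β_merged`, the (1.22) second moment of the limit
kernel (1.21) of ONE merged term family `𝓝_{k+1}` ([I] (1.6)) — `Node00.betaMerged F ℰ ρ bV`; (ii) the convention of record off the
box is the SPLIT-COMPATIBLE form `β⁰_k + 𝟙_{Box γ k}·(β_merged − β⁰_k)` with `β⁰` a NAMED OBJECT (the one-loop number) —
`Node00.betaOfMerged βm β⁰ γ`, whose one-loop split `oneLoopSplit_betaOfMerged` holds BY CONSTRUCTION with `β0 := β⁰`.  At that β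
the remainder `β¹_{k+1}(p) = β_merged(p) − β⁰_{k+1}` is NOT definitionally the second moment of a separate remainder kernel, so the
(D4) chain's field `beta1_eq` costs ONE MORE located identity than in the two-family shape: the merged limit kernel SPLITS as the
history-free one-loop kernel `Π⁰_{k+1}` plus the leaf sum `Σ'_Y A¹_{k+1}(p; Y, ·)` ([I] (2.12)–(2.13): merged term = `log Z^{(k)}` +
`E^{(k+1)}`, Hessians add; (1.7) for the remainder), with `β⁰_{k+1} = Σ_z Π⁰_{k+1}(z) z₀z₁` and (5.10) for `Π⁰` (absolute convergence,
so that (1.22) is additive — `B12Sec2to5.secondMoment_abs_le_of_decay510`).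

WHAT IS HERE (compositions BY NAME; no definition, no restatement, 0 `sorry`):
* §1 `atSlopeCont_betaOfMerged` — THE (D4) SOCKET AT THE MERGED β OF RECORD: from the one-loop kernels `P0 k`, `hβ0 : β⁰ k =
  Σ_z P0 k z · z₀z₁`, per-scale (5.10) for `P0 k`, leaf kernels `A1`, the split identity `hrep : polLimit F (k+1) (ℰ k p ·) ρ bV 0 1 z
  = P0 k z + Σ'_Y A1 k p Y z` on the box `γ₀ ≤ γ`, the leaves `PolLeavesTFac190H 4 M (A1 k p) c ℓ α₂ q`, `CondsL ∕ R22gen ∕ Valid ∕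
  SignsL`, smallness, and (C-pt) for the merged limit kernel ⟹ `AtSlopeCont (oneLoopSplit_betaOfMerged (betaMerged F ℰ ρ bV) β⁰ γ)
  γ₀ s` (the `ChainTFac190H` inhabitant is BUILT: `beta1_eq` from the definition + `hrep` + additivity of (1.22); `CPt` = (C-pt) minus
  the history-free `P0`); then `betaContH_betaOfMerged_of_localizedRep` (B4 on the box, no smallness), `n26lit_betaOfMerged_of_
  localizedRep` (N26's literal, `γc := γ₀`, `0 < γ₀` declared), `remainderConst_betaOfMerged_of_localizedRep` (the wall's constant form).
* §2 (C-pt) AT FINITE VOLUME IN PRINTED TYPE ([folklore] calculus, `ContDiffAt.fderiv` twice): joint `C²` regularity of the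
  charted term functional `(x, B) ↦ 𝐄_x(exp ρB)` at `(x, 0)` — or of `(x, U) ↦ 𝐄_x(U)` at `(x, 1)`, `𝔄` complete — for the parameters
  `x ∈ s` ⟹ the windowed kernel `x ↦ polWindow F K j (ℰ x) ρ bV μ ν z` is continuous on `s` (`continuousAt_polTensor_of_contDiffAt`,
  `continuousOn_polWindow_of_contDiffAt`, `continuousOn_polWindow_of_contDiffAt_config`) — the finite-volume clause `hK` of the
  companion's `n26lit_betaOfTerms_of_finiteVolume` ([I] (1.9) p. 261: analytic in the field; p. 264: smooth in the coupling).
* §3 CONSISTENCY (audit A2 only; HONESTY LABEL: the ZERO merged family `ℰ ≡ 0` with `P0 = 0`, `β⁰ = 0`, `A1 = 0`, the zero leaves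
  of `Beta.RemainderWitness` at the records `c₀ 4`, `q₀` — the WRONG objects for Bałaban, the zero-activity witness GAPS §B
  excludes from every count; no discharge reads through it): `socket_hypotheses_satisfiable_zeroFamily` — the hypothesis list of
  §1 (and of the companion's `atSlopeCont_betaOfTerms`, which is the sub-list with `P0` absent) is jointly satisfiable.

HONEST FRAMING.  Bookkeeping by name; NO estimate of Bałaban's series is proved; `ℰ`, `P0`, `β⁰`, `A1` are PARAMETERS (Stage ₈
(a)–(c), NODE O); for Bałaban's objects every hypothesis is a located input (instance 0∕1) and N26 stays VACATED in the discharge form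
of record (closes WITH N25).  One finite four-torus programme at fixed ε per run; NOT ℝ⁴, NOT infinite volume, NOT OS, NOT a mass
gap, NOT Clay.  Sources (context): [I] = Balaban1987RG1 (1.6)–(1.7) p. 261, (1.20)–(1.22) p. 264, (2.12)–(2.14) p. 268, (5.10)
p. 293; [II] = Balaban1988RG2Cluster Lemma 3 (2.38) p. 20.
-/

noncomputable section

namespace Summit.QuantumFields.YangMills.Theorems.BalabanUVNodesN26Merged

open Literature.MathematicalPhysics.QuantumFieldTheory.Balaban1983to89
open Literature.MathematicalPhysics.QuantumFieldTheory.Balaban1983to89.FlowStep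
open Literature.MathematicalPhysics.QuantumFieldTheory.Balaban1983to89.T4Continuum (T4Family)
open Literature.MathematicalPhysics.QuantumFieldTheory.Balaban1983to89.Node00
open Literature.MathematicalPhysics.QuantumFieldTheory.Balaban1983to89.B13ScaleTransfer (Pt)
open Literature.MathematicalPhysics.QuantumFieldTheory.Balaban1983to89.Beta.RemainderChain (RemainderConst)
open Literature.MathematicalPhysics.QuantumFieldTheory.Balaban1983to89.Beta.RemainderChainLattice
open Literature.MathematicalPhysics.QuantumFieldTheory.Balaban1983to89.Beta.RemainderLimitTorus (LDom limKernel)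
open Literature.MathematicalPhysics.QuantumFieldTheory.Balaban1983to89.Beta.RemainderLimitTorusHolo
open Literature.MathematicalPhysics.QuantumFieldTheory.Balaban1983to89.Beta.RemainderDecay190
open Literature.MathematicalPhysics.QuantumFieldTheory.Balaban1983to89.Beta.RemainderDecay190HoloChain
open Literature.MathematicalPhysics.QuantumFieldTheory.Balaban1983to89.Beta.RemainderLocalityHolo
  (PolLeavesTFac190H PolLeavesTFac190H.ofAnalytic)
open Literature.MathematicalPhysics.QuantumFieldTheory.Balaban1983to89.Beta.RemainderWitness
  (c₀ q₀ zeroLeaves190 limKernel_zero c₀_condsL c₀_R22gen c₀_activity_pos q₀_valid_c₀)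
open Summit.QuantumFields.BalabanUV.Gaps
open Summit.QuantumFields.BalabanUV.Gaps.BetaContFromD4Chain
open Filter Topology

variable {𝔄 : Type*} [NormedRing 𝔄] [NormedAlgebra ℝ 𝔄]
variable {V : Type*} [NormedAddCommGroup V] [NormedSpace ℝ V] {ι : Type*} [Fintype ι]

/-! ## §1 The (D4) socket at the merged β of record -/

section Socket

variable (F : T4Family) (ℰ : TermFamily1 F 𝔄) (ρ : V →L[ℝ] 𝔄) (bV : Module.Basis ι ℝ V) (β0 : ℕ → ℝ)
variable {γ γ₀ : ℝ} {M : ℕ} [NeZero M] {c : B13.Consts} {ℓ α₂ : ℝ} {q : Consts190}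

/-- (1.22) is ADDITIVE in the kernel when both summands converge absolutely: the second moment of `P0 + A` in the channel
`(0, 1)` is the sum of the second moments ((5.10)-type decay of each summand ⇒ absolute convergence,
`B12Sec2to5.secondMoment_abs_le_of_decay510`). [cite: Balaban1987RG1, (1.22) p.264 and (5.10) p.293] -/
theorem secondMoment_eq_add_of_decay510 {P P0 A : Pt 4 → ℝ} {C₀ δ₀ C₁ δ₁ : ℝ} (hδ₀ : 0 < δ₀) (hδ₁ : 0 < δ₁)
    (h0 : B12Sec2to5.Decay510 P0 C₀ δ₀) (h1 : B12Sec2to5.Decay510 A C₁ δ₁) (hP : ∀ z, P z = P0 z + A z) :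
    B12Beta.secondMoment (fun _ _ => P) 0 1 =
      B12Beta.secondMoment (fun _ _ => P0) 0 1 + B12Beta.secondMoment (fun _ _ => A) 0 1 := by
  have hS0 := (B12Sec2to5.secondMoment_abs_le_of_decay510 (P := fun _ _ => P0) (μ := 0) (ν := 1) hδ₀ h0).1
  have hS1 := (B12Sec2to5.secondMoment_abs_le_of_decay510 (P := fun _ _ => A) (μ := 0) (ν := 1) hδ₁ h1).1
  unfold B12Beta.secondMoment
  rw [← hS0.tsum_add hS1]
  exact tsum_congr fun z => by simp only [hP z]; ring

/-- **`AtSlopeCont` AT THE MERGED β OF RECORD — the (D4)-chain inhabitant for `oneLoopSplit_betaOfMerged (betaMerged F ℰ ρ bV) β⁰ γ`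
BY NAME.**  Inputs, all declared: the box `γ₀ ≤ γ`; the history-free one-loop kernels `P0 k` with `hβ0 : β⁰ k = Σ_z P0 k z · z₀z₁`
(the one-loop NUMBER of the record IS the second moment of the coupling-free kernel — [I] (2.12), (1.22) at `g = 0`) and their
per-scale (5.10) decay `hP0`; NODE O's leaf kernels `A1 k p`; `hrep` — the merged limit kernel (1.21) SPLITS on the box as
`polLimit F (k+1) (ℰ k p ·) ρ bV 0 1 z = P0 k z + Σ'_Y A1 k p Y z` ([I] (2.12)–(2.13) with the localized representation (1.7) of the
remainder; a theorem of [I]∕[II] for Bałaban's objects, here a hypothesis); the [II]-(2.38) ∕ (190) ∕ (1.7) ∕ (4.4) leaves `hleaves`;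
`CondsL`, `R22gen`, `Consts190.Valid`, `SignsL`; smallness `ε₁·K_rem,L ≤ s`; (C-pt) for the merged limit kernel on the box.  THEN
`ChainTFac190H 4 M 0 1 (oneLoopSplit_betaOfMerged (betaMerged F ℰ ρ bV) β⁰ γ) γ₀ c ℓ α₂ q` is INHABITED (`beta1_eq`: on the box
`β¹ = β_merged − β⁰ = Σ(P0 + ΣA1)z₀z₁ − ΣP0 z₀z₁ = Σ(Σ'A1)z₀z₁` by additivity, the leaves' own (5.10) giving the second summability;
`CPt`: (C-pt) minus the constant `P0 k z`), and `Gaps.BetaContFromD4Chain.atSlopeCont_of_chainTFac190H` gives the residue.  For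
Bałaban's objects: instance 0∕1, nothing discharged.
[cite: Balaban1987RG1, (1.7) p.261, (1.20)-(1.22) p.264 and (2.12)-(2.13) p.268; Balaban1988RG2Cluster, Lemma 3 (2.38) p.20] -/
theorem atSlopeCont_betaOfMerged (hle : γ₀ ≤ γ) {s : ℝ} (P0 : ℕ → Pt 4 → ℝ)
    (hβ0 : ∀ k, β0 k = B12Beta.secondMoment (fun _ _ => P0 k) 0 1)
    (hP0 : ∀ k, ∃ C δ₁ : ℝ, 0 < δ₁ ∧ B12Sec2to5.Decay510 (P0 k) C δ₁)
    (A1 : (k : ℕ) → (Fin (k + 1) → ℝ) → LDom 4 → Pt 4 → ℝ)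
    (hrep : ∀ k (p : Fin (k + 1) → ℝ), p ∈ Box γ₀ k → ∀ z : Pt 4,
      polLimit F (k + 1) (fun K => ℰ k p K) ρ bV 0 1 z = P0 k z + limKernel (A1 k p) z)
    (hleaves : ∀ k (p : Fin (k + 1) → ℝ), p ∈ Box γ₀ k → PolLeavesTFac190H 4 M (A1 k p) c ℓ α₂ q)
    (hC : CondsL 4 c ℓ) (h22 : c.R22gen ℓ) (hq : q.Valid c.δ₀) (hs : SignsL c α₂ q.B₃)
    (hsmall : c.ε₁ * remCoeffL 4 M c α₂ q.B₃ ≤ s)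
    (hcont : ∀ k (z : Pt 4), ContinuousOn
      (fun p : Fin (k + 1) → ℝ => polLimit F (k + 1) (fun K => ℰ k p K) ρ bV 0 1 z) (Box γ₀ k)) :
    AtSlopeCont (oneLoopSplit_betaOfMerged (betaMerged F ℰ ρ bV) β0 γ) γ₀ s := by
  let R : ChainTFac190H 4 M 0 1 (oneLoopSplit_betaOfMerged (betaMerged F ℰ ρ bV) β0 γ) γ₀ c ℓ α₂ q :=
    { A1 := A1
      beta1_eq := fun k p hp => by
        have hp' : p ∈ Box γ₀ k := (histBox_eq_box γ₀ k) ▸ hp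
        obtain ⟨C₀, δ₀, hδ₀, h0⟩ := hP0 k
        have h1 : B12Sec2to5.Decay510 (limKernel (A1 k p)) (Beta.RemainderChain.remActivity c * polConstL 4 M c α₂ q.B₃)
            (deltaL 4 M c) :=
          (((hleaves k p hp').toPolLeavesTFacH hq).toPolLeavesTLocH hs.α₂_pos).decay510 hC h22 hs (by norm_num)
        have hadd := secondMoment_eq_add_of_decay510 hδ₀ (deltaL_pos hC hs.δ₀_pos (by norm_num) (Nat.pos_of_neZero M))
          h0 h1 (hrep k p hp')
        show (Box γ k).indicator (fun w => betaMerged F ℰ ρ bV k w - β0 k) p = _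
        rw [Set.indicator_of_mem (box_mono hle k hp'), hβ0 k]
        show B12Beta.secondMoment (polLimit F (k + 1) (fun K => ℰ k p K) ρ bV) 0 1 - _ = _
        have hP : B12Beta.secondMoment (polLimit F (k + 1) (fun K => ℰ k p K) ρ bV) 0 1 =
            B12Beta.secondMoment (fun _ _ => polLimit F (k + 1) (fun K => ℰ k p K) ρ bV 0 1) 0 1 := rfl
        rw [hP, hadd]
        ring
      leaves := fun k p hp => hleaves k p ((histBox_eq_box γ₀ k) ▸ hp) }
  refine atSlopeCont_of_chainTFac190H R hC h22 hq hs hsmall fun k z => ?_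
  have h : ContinuousOn (fun p : Fin (k + 1) → ℝ => polLimit F (k + 1) (fun K => ℰ k p K) ρ bV 0 1 z - P0 k z)
      (Box γ₀ k) := (hcont k z).sub continuousOn_const
  exact h.congr fun p hp => by
    show limKernel (A1 k p) z = polLimit F (k + 1) (fun K => ℰ k p K) ρ bV 0 1 z - P0 k z
    rw [hrep k p hp z]; ring

/-- **B4 ON THE BOX `γ₀` AT THE MERGED β OF RECORD from the same located inputs, no smallness clause** (`s := ε₁·K_rem,L`, then
`Gaps.BetaContFromD4Chain.betaContH_of_atSlopeCont` BY NAME). [cite: Balaban1987RG1, (1.22) p.264 and (5.10) p.293] -/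
theorem betaContH_betaOfMerged_of_localizedRep (hle : γ₀ ≤ γ) (P0 : ℕ → Pt 4 → ℝ)
    (hβ0 : ∀ k, β0 k = B12Beta.secondMoment (fun _ _ => P0 k) 0 1)
    (hP0 : ∀ k, ∃ C δ₁ : ℝ, 0 < δ₁ ∧ B12Sec2to5.Decay510 (P0 k) C δ₁)
    (A1 : (k : ℕ) → (Fin (k + 1) → ℝ) → LDom 4 → Pt 4 → ℝ)
    (hrep : ∀ k (p : Fin (k + 1) → ℝ), p ∈ Box γ₀ k → ∀ z : Pt 4,
      polLimit F (k + 1) (fun K => ℰ k p K) ρ bV 0 1 z = P0 k z + limKernel (A1 k p) z)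
    (hleaves : ∀ k (p : Fin (k + 1) → ℝ), p ∈ Box γ₀ k → PolLeavesTFac190H 4 M (A1 k p) c ℓ α₂ q)
    (hC : CondsL 4 c ℓ) (h22 : c.R22gen ℓ) (hq : q.Valid c.δ₀) (hs : SignsL c α₂ q.B₃)
    (hcont : ∀ k (z : Pt 4), ContinuousOn
      (fun p : Fin (k + 1) → ℝ => polLimit F (k + 1) (fun K => ℰ k p K) ρ bV 0 1 z) (Box γ₀ k)) :
    BetaContH γ₀ (betaOfMerged (betaMerged F ℰ ρ bV) β0 γ) :=
  betaContH_of_atSlopeCont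
    (atSlopeCont_betaOfMerged F ℰ ρ bV β0 hle P0 hβ0 hP0 A1 hrep hleaves hC h22 hq hs le_rfl hcont)

/-- **N26's LITERAL AT THE MERGED β OF RECORD from the (D4) socket's located inputs + (C-pt) + `0 < γ₀ ≤ γ`** (`γc := γ₀`).
[cite: Balaban1987RG1, (1.22) p.264 and (5.10) p.293; Balaban1988RG2Cluster, Lemma 3 (2.38) p.20] -/
theorem n26lit_betaOfMerged_of_localizedRep (hγ₀ : 0 < γ₀) (hle : γ₀ ≤ γ) (P0 : ℕ → Pt 4 → ℝ)
    (hβ0 : ∀ k, β0 k = B12Beta.secondMoment (fun _ _ => P0 k) 0 1)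
    (hP0 : ∀ k, ∃ C δ₁ : ℝ, 0 < δ₁ ∧ B12Sec2to5.Decay510 (P0 k) C δ₁)
    (A1 : (k : ℕ) → (Fin (k + 1) → ℝ) → LDom 4 → Pt 4 → ℝ)
    (hrep : ∀ k (p : Fin (k + 1) → ℝ), p ∈ Box γ₀ k → ∀ z : Pt 4,
      polLimit F (k + 1) (fun K => ℰ k p K) ρ bV 0 1 z = P0 k z + limKernel (A1 k p) z)
    (hleaves : ∀ k (p : Fin (k + 1) → ℝ), p ∈ Box γ₀ k → PolLeavesTFac190H 4 M (A1 k p) c ℓ α₂ q)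
    (hC : CondsL 4 c ℓ) (h22 : c.R22gen ℓ) (hq : q.Valid c.δ₀) (hs : SignsL c α₂ q.B₃)
    (hcont : ∀ k (z : Pt 4), ContinuousOn
      (fun p : Fin (k + 1) → ℝ => polLimit F (k + 1) (fun K => ℰ k p K) ρ bV 0 1 z) (Box γ₀ k)) :
    ∃ γc : ℝ, 0 < γc ∧ BetaContH γc (betaOfMerged (betaMerged F ℰ ρ bV) β0 γ) :=
  ⟨γ₀, hγ₀, betaContH_betaOfMerged_of_localizedRep F ℰ ρ bV β0 hle P0 hβ0 hP0 A1 hrep hleaves hC h22 hq hs hcont⟩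

/-- **The wall's constant form at the merged record's split**: `RemainderConst (oneLoopSplit_betaOfMerged …) γ₀ s`, i.e.
`|β_merged(p) − β⁰_{k+1}| ≤ s` on the boxes (`remainderConst_of_atSlopeCont`; N25's END reads it at `s := stepBal N Lc`).
[cite: Balaban1988RG2Cluster, Lemma 3 (2.38) p.20; Balaban1987RG1, (1.22) p.264] -/
theorem remainderConst_betaOfMerged_of_localizedRep (hle : γ₀ ≤ γ) {s : ℝ} (P0 : ℕ → Pt 4 → ℝ)
    (hβ0 : ∀ k, β0 k = B12Beta.secondMoment (fun _ _ => P0 k) 0 1)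
    (hP0 : ∀ k, ∃ C δ₁ : ℝ, 0 < δ₁ ∧ B12Sec2to5.Decay510 (P0 k) C δ₁)
    (A1 : (k : ℕ) → (Fin (k + 1) → ℝ) → LDom 4 → Pt 4 → ℝ)
    (hrep : ∀ k (p : Fin (k + 1) → ℝ), p ∈ Box γ₀ k → ∀ z : Pt 4,
      polLimit F (k + 1) (fun K => ℰ k p K) ρ bV 0 1 z = P0 k z + limKernel (A1 k p) z)
    (hleaves : ∀ k (p : Fin (k + 1) → ℝ), p ∈ Box γ₀ k → PolLeavesTFac190H 4 M (A1 k p) c ℓ α₂ q)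
    (hC : CondsL 4 c ℓ) (h22 : c.R22gen ℓ) (hq : q.Valid c.δ₀) (hs : SignsL c α₂ q.B₃)
    (hsmall : c.ε₁ * remCoeffL 4 M c α₂ q.B₃ ≤ s)
    (hcont : ∀ k (z : Pt 4), ContinuousOn
      (fun p : Fin (k + 1) → ℝ => polLimit F (k + 1) (fun K => ℰ k p K) ρ bV 0 1 z) (Box γ₀ k)) :
    RemainderConst (oneLoopSplit_betaOfMerged (betaMerged F ℰ ρ bV) β0 γ) γ₀ s :=
  remainderConst_of_atSlopeCont
    (atSlopeCont_betaOfMerged F ℰ ρ bV β0 hle P0 hβ0 hP0 A1 hrep hleaves hC h22 hq hs hsmall hcont)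

end Socket

/-! ## §2 (C-pt) AT FINITE VOLUME from joint `C²` regularity of the term functional in (history, field) — the printed TYPE of the
finite-volume clause ([I] p. 261 (1.9): `E^{(j)}` analytic in the field; p. 264 after (1.22): smooth in the coupling) -/

section FiniteVolume

variable {X : Type*} [NormedAddCommGroup X] [NormedSpace ℝ X]
variable {Λ T : Type*} [Fintype Λ] [Fintype T] [DecidableEq Λ] [DecidableEq T] {W : Type*} [NormedAddCommGroup W]
  [NormedSpace ℝ W] {G : Type*} [NormedAddCommGroup G] [NormedSpace ℝ G]

/-- **The (1.20) Hessian components depend continuously on a parameter under joint `C²` regularity** ([folklore] calculus;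
`ContDiffAt.fderiv` twice): if `(x, B) ↦ f x B` is `C²` at `(x₀, 0)` JOINTLY in the parameter `x` (the coupling history, say) and the
field `B`, then every component `x ↦ D²_B (f x)(0)(δ_{μ,x}v, δ_{ν,y}w)` of the Hessian at `B = 0` is continuous at `x₀`. -/
theorem continuousAt_polTensor_of_contDiffAt (f : X → (Λ → T → W) → G) {x₀ : X}
    (hf : ContDiffAt ℝ 2 (Function.uncurry f) (x₀, 0)) (μ : Λ) (a : T) (v : W) (ν : Λ) (b : T) (w : W) :
    ContinuousAt (fun x => B12PolarizationTensor120.polTensor ℝ (f x) μ a v ν b w) x₀ := by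
  -- the field-derivative `(x, B) ↦ D_B (f x)(B)` is jointly `C¹` at `(x₀, 0)`
  have hF : ContDiffAt ℝ 2 (Function.uncurry fun (q : X × (Λ → T → W)) (B : Λ → T → W) => f q.1 B)
      ((x₀, (0 : Λ → T → W)), (0 : Λ → T → W)) :=
    hf.comp ((x₀, (0 : Λ → T → W)), (0 : Λ → T → W)) (contDiffAt_fst.fst.prodMk contDiffAt_snd)
  have h1 : ContDiffAt ℝ 1 (fun q : X × (Λ → T → W) => fderiv ℝ (f q.1) q.2) (x₀, 0) :=
    hF.fderiv contDiffAt_snd (by norm_num)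
  -- hence `x ↦ D²_B (f x)(0)` is `C⁰`, i.e. continuous, at `x₀`
  have h2 : ContDiffAt ℝ 0 (fun x : X => fderiv ℝ (fun B : Λ → T → W => fderiv ℝ (f x) B) 0) x₀ :=
    h1.fderiv (g := fun _ : X => (0 : Λ → T → W)) contDiffAt_const (by norm_num)
  have h3 : ContinuousAt (fun x : X => fderiv ℝ (fderiv ℝ (f x)) 0) x₀ := h2.continuousAt
  exact (h3.clm_apply continuousAt_const).clm_apply continuousAt_const

variable (F : T4Family) (ρ : V →L[ℝ] 𝔄) (bV : Module.Basis ι ℝ V)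

/-- **(C-pt) AT FINITE VOLUME, CHART LEVEL**: if for every parameter `x ∈ s` the charted term functional `(x, B) ↦ 𝐄_x(exp ρB)` on the
`K`-th torus is jointly `C²` at `(x, 0)`, then the windowed kernel `x ↦ polWindow F K j (ℰ x) ρ bV μ ν z` is continuous on `s` (the
normalised trace of finitely many Hessian components).  This is the finite-volume clause `hK` of the companion's
`n26lit_betaOfTerms_of_finiteVolume` in printed type. [cite: Balaban1987RG1, (1.9) p.261 and (1.20)-(1.22) p.264] -/
theorem continuousOn_polWindow_of_contDiffAt {s : Set X} (K j : ℕ)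
    (ℰ : X → (Fin (F.P K).d → Site (F.P K) j → 𝔄) → ℝ)
    (hℰ : ∀ x ∈ s, ContDiffAt ℝ 2
      (Function.uncurry fun (x : X) (B : Fin (F.P K).d → Site (F.P K) j → V) =>
        B12PolarizationTensor120.expChart (ℰ x) ρ B) (x, 0))
    (μ ν : Fin 4) (z : Fin 4 → ℤ) : ContinuousOn (fun x => polWindow F K j (ℰ x) ρ bV μ ν z) s := by
  unfold polWindow polScalar B12PolarizationTensor120.polComp
  refine continuousOn_const.mul (continuousOn_finsetSum _ fun a _ => fun x hx => ?_)
  exact (continuousAt_polTensor_of_contDiffAt (fun x => B12PolarizationTensor120.expChart (ℰ x) ρ) (hℰ x hx)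
    _ _ _ _ _ _).continuousWithinAt

/-- **(C-pt) AT FINITE VOLUME, CONFIGURATION LEVEL** (`𝔄` complete, for the exponential chart): joint `C²` regularity of
`(x, U) ↦ 𝐄_x(U)` at `(x, 1)` for `x ∈ s` (print: analytic in `U` (1.9), smooth in the couplings p. 264) gives the same conclusion — the
chart `B ↦ exp ρB` is smooth (`B12Semisimple414.contDiff_chart`) with `exp ρ0 = 1`. [cite: Balaban1987RG1, (1.9) p.261 and (1.20)-(1.22) p.264] -/
theorem continuousOn_polWindow_of_contDiffAt_config [CompleteSpace 𝔄] {s : Set X} (K j : ℕ)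
    (ℰ : X → (Fin (F.P K).d → Site (F.P K) j → 𝔄) → ℝ)
    (hℰ : ∀ x ∈ s, ContDiffAt ℝ 2 (Function.uncurry ℰ) (x, 1)) (μ ν : Fin 4) (z : Fin 4 → ℤ) :
    ContinuousOn (fun x => polWindow F K j (ℰ x) ρ bV μ ν z) s := by
  refine continuousOn_polWindow_of_contDiffAt F ρ bV K j ℰ (fun x hx => ?_) μ ν z
  have hch := B12Semisimple414.contDiff_chart (Λ := Fin (F.P K).d) (T := Site (F.P K) j) ρ (n := 2)
  have h0 : (fun B : Fin (F.P K).d → Site (F.P K) j → V => fun ν y => NormedSpace.exp (ρ (B ν y))) 0 = 1 :=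
    B12Semisimple414.chart_zero ρ
  have hin : ContDiffAt ℝ 2 (fun q : X × (Fin (F.P K).d → Site (F.P K) j → V) =>
      (q.1, fun ν y => NormedSpace.exp (ρ (q.2 ν y)))) (x, 0) :=
    contDiffAt_fst.prodMk (hch.contDiffAt.comp (x, (0 : Fin (F.P K).d → Site (F.P K) j → V)) contDiffAt_snd)
  have hx' : ContDiffAt ℝ 2 (Function.uncurry ℰ)
      ((fun q : X × (Fin (F.P K).d → Site (F.P K) j → V) => (q.1, fun ν y => NormedSpace.exp (ρ (q.2 ν y)))) (x, 0)) := by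
    simpa only [h0] using hℰ x hx
  exact hx'.comp (x, (0 : Fin (F.P K).d → Site (F.P K) j → V)) hin

end FiniteVolume

/-! ## §3 Consistency of the socket hypothesis lists (audit A2 only) — the ZERO merged family with zero one-loop kernel, zero
leaves at the witness records `c₀ 4`, `q₀` of `Beta.RemainderWitness`; HONESTY LABEL: the WRONG objects for Bałaban (the
zero-activity witness, excluded from every count), a satisfiability check of the typed hypotheses, NOT an instance -/

section Satisfiable

variable (F : T4Family) (ρ : V →L[ℝ] 𝔄) (bV : Module.Basis ι ℝ V)

/-- **A2: the hypothesis list of `atSlopeCont_betaOfMerged` is jointly satisfiable, and the socket fires** — witnesses: merged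
family `ℰ ≡ 0`, `β⁰ ≡ 0`, one-loop kernels `P0 ≡ 0`, leaf kernels `A1 ≡ 0`, records `c := c₀ 4`, `ℓ := 2`, `α₂ := 1`, `q := q₀`, the
zero leaves `zeroLeaves190` (through `PolLeavesTFac190H.ofAnalytic`), any box `γ₀ ≤ γ`, slope `s := ε₁(c₀ 4)·K_rem,L`; the limit kernel
of the zero family is `0` (`BalabanUVNodesN26Record.polLimit_zero`).  The companion's `atSlopeCont_betaOfTerms` has the sub-list
without `P0` (its `hrep` is the fourth conjunct with `P0 = 0`), so it is covered.  HONESTY LABEL: these are NOT Bałaban's objects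
(no remainder, no one-loop term); the instance count stays 0∕1 and nothing is read through this theorem. -/
theorem socket_hypotheses_satisfiable_zeroFamily (M : ℕ) [NeZero M] {γ γ₀ : ℝ} (hle : γ₀ ≤ γ) :
    ∃ (ℰ : TermFamily1 F 𝔄) (β0 : ℕ → ℝ) (P0 : ℕ → Pt 4 → ℝ) (A1 : (k : ℕ) → (Fin (k + 1) → ℝ) → LDom 4 → Pt 4 → ℝ)
      (c : B13.Consts) (ℓ α₂ : ℝ) (q : Consts190),
      (∀ k, β0 k = B12Beta.secondMoment (fun _ _ => P0 k) 0 1) ∧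
      (∀ k, ∃ C δ₁ : ℝ, 0 < δ₁ ∧ B12Sec2to5.Decay510 (P0 k) C δ₁) ∧
      (∀ k (p : Fin (k + 1) → ℝ), p ∈ Box γ₀ k → ∀ z : Pt 4,
        polLimit F (k + 1) (fun K => ℰ k p K) ρ bV 0 1 z = P0 k z + limKernel (A1 k p) z) ∧
      (∀ k (p : Fin (k + 1) → ℝ), p ∈ Box γ₀ k → ∀ z : Pt 4,
        polLimit F (k + 1) (fun K => ℰ k p K) ρ bV 0 1 z = limKernel (A1 k p) z) ∧
      (∀ k (p : Fin (k + 1) → ℝ), p ∈ Box γ₀ k → Nonempty (PolLeavesTFac190H 4 M (A1 k p) c ℓ α₂ q)) ∧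
      CondsL 4 c ℓ ∧ c.R22gen ℓ ∧ q.Valid c.δ₀ ∧ SignsL c α₂ q.B₃ ∧
      (∀ k (z : Pt 4), ContinuousOn
        (fun p : Fin (k + 1) → ℝ => polLimit F (k + 1) (fun K => ℰ k p K) ρ bV 0 1 z) (Box γ₀ k)) ∧
      AtSlopeCont (oneLoopSplit_betaOfMerged (betaMerged F ℰ ρ bV) β0 γ) γ₀ (c.ε₁ * remCoeffL 4 M c α₂ q.B₃) := by
  have hA : 0 ≤ (c₀ 4).C3act * (c₀ 4).ε₁ := (c₀_activity_pos 4).le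
  have hs : SignsL (c₀ 4) 1 q₀.B₃ := (q₀_valid_c₀ 4).signsL hA one_pos D4Residue.c₀_four_δ₀_pos
  have hL : ∀ (k : ℕ) (z : Pt 4),
      polLimit F (k + 1) (fun K => fun _ : Fin (F.P K).d → Site (F.P K) (k + 1) → 𝔄 => (0 : ℝ)) ρ bV 0 1 z = 0 :=
    fun k z => BalabanUVNodesN26Record.polLimit_zero F ρ bV (k + 1) 0 1 z
  have hβ0 : ∀ k : ℕ, (0 : ℝ) = B12Beta.secondMoment (fun _ _ => fun _ : Pt 4 => (0 : ℝ)) 0 1 := fun k => by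
    simp [B12Beta.secondMoment]
  have hP0 : ∀ k : ℕ, ∃ C δ₁ : ℝ, 0 < δ₁ ∧ B12Sec2to5.Decay510 (fun _ : Pt 4 => (0 : ℝ)) C δ₁ :=
    fun _ => ⟨0, 1, one_pos, fun z => by simp⟩
  have hrep : ∀ k (p : Fin (k + 1) → ℝ), p ∈ Box γ₀ k → ∀ z : Pt 4,
      polLimit F (k + 1) (fun K => fun _ : Fin (F.P K).d → Site (F.P K) (k + 1) → 𝔄 => (0 : ℝ)) ρ bV 0 1 z =
        (fun _ : Pt 4 => (0 : ℝ)) z + limKernel (fun (_ : LDom 4) (_ : Pt 4) => (0 : ℝ)) z :=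
    fun k p _ z => by simp only [hL k z, limKernel_zero, add_zero]
  have hleaves : ∀ k (p : Fin (k + 1) → ℝ), p ∈ Box γ₀ k →
      PolLeavesTFac190H 4 M (fun (_ : LDom 4) (_ : Pt 4) => (0 : ℝ)) (c₀ 4) 2 1 q₀ :=
    fun _ _ _ => PolLeavesTFac190H.ofAnalytic (zeroLeaves190 4 M (c₀ 4) 2 1 hA)
  have hcont : ∀ k (z : Pt 4), ContinuousOn (fun p : Fin (k + 1) → ℝ =>
      polLimit F (k + 1) (fun K => fun _ : Fin (F.P K).d → Site (F.P K) (k + 1) → 𝔄 => (0 : ℝ)) ρ bV 0 1 z) (Box γ₀ k) :=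
    fun k z => by simp only [hL]; exact continuousOn_const
  refine ⟨fun _ _ _ _ => 0, fun _ => 0, fun _ _ => 0, fun _ _ _ _ => 0, c₀ 4, 2, 1, q₀, hβ0, hP0, hrep,
    fun k p _ z => by rw [hL k z, limKernel_zero], fun k p hp => ⟨hleaves k p hp⟩, c₀_condsL 4, c₀_R22gen 4, q₀_valid_c₀ 4,
    hs, hcont, ?_⟩
  exact atSlopeCont_betaOfMerged F (fun _ _ _ _ => 0) ρ bV (fun _ => 0) hle (fun _ _ => 0) hβ0 hP0
    (fun _ _ _ _ => 0) hrep hleaves (c₀_condsL 4) (c₀_R22gen 4) (q₀_valid_c₀ 4) hs le_rfl hcont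

end Satisfiable

end Summit.QuantumFields.YangMills.Theorems.BalabanUVNodesN26Merged

end
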